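import Mathlib

/-!
# Nilpotent semigroups: Proposition 8.1.2 and Corollary 8.1.3

[Ganyushkin–Mazorchuk 2009, §8.1].  A semigroup `S` with zero is *nilpotent* if `S^k = {0}` for
some `k`, i.e. every product of `k` elements of `S` vanishes; the least such `k` is the
nilpotency degree `nd(S)`.  Here `S` is a subsemigroup, containing `0`, of a monoid with zero
`M` (every semigroup with zero is such a subsemigroup of `S¹`), and "every product of `k`
elements of `S` is `0`" is stated for lists of elements of `S` of length `≥ k`.

* Proposition 8.1.2: a finite semigroup with zero is nilpotent iff each of its elements is
  nilpotent (`list_prod_eq_zero_of_forall_isNilpotent`, `isNilpotent_of_list_prod_eq_zero`);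
* Corollary 8.1.3: then `nd(S) ≤ |S|` — the bound `k = |S|` is the one produced
  (`list_prod_eq_zero_of_forall_isNilpotent`).

## References
* [GanyushkinMazorchuk2009] O. Ganyushkin, V. Mazorchuk, *Classical Finite Transformation
  Semigroups. An Introduction*, Algebra and Applications 9, Springer, 2009, §8.1.
-/

namespace Literature.Algebra.Semigroups.Nilpotent

variable {M : Type*} [MonoidWithZero M]

/-- A product of a nonempty list of elements of a subsemigroup lies in it. [folklore] -/
private theorem list_prod_mem {S : Subsemigroup M} :
    ∀ {l : List M}, l ≠ [] → (∀ a ∈ l, a ∈ S) → l.prod ∈ S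
  | [], h, _ => absurd rfl h
  | [a], _, h => by simpa using h a (by simp)
  | a :: b :: l, _, h => by
    rw [List.prod_cons]
    exact S.mul_mem (h a (by simp)) (list_prod_mem (List.cons_ne_nil b l)
      fun x hx => h x (List.mem_cons_of_mem a hx))

/-- If `b x = b` then `b xᵐ = b` for all `m` (equation (8.1)). [folklore] -/
private theorem mul_pow_eq_self {b x : M} (h : b * x = b) : ∀ m : ℕ, b * x ^ m = b
  | 0 => by simp
  | m + 1 => by rw [pow_succ', ← mul_assoc, h, mul_pow_eq_self h m]

/-- Proposition 8.1.2, (b) ⇒ (a), with the bound of Corollary 8.1.3: let `S` be a finite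
subsemigroup with `0 ∈ S` of a monoid with zero, all of whose elements are nilpotent.  Then every
product `a₁ a₂ ⋯ a_k` of `k ≥ |S|` elements of `S` is `0`; i.e. `S` is nilpotent with
`nd(S) ≤ |S|`.  (Proof as printed: the prefixes `bᵢ = a₁ ⋯ aᵢ` of a nonzero product are nonzero
and pairwise distinct, since `bᵢ = b_j = bᵢ x` would give `bᵢ = bᵢ xᵐ = 0`.)
[cite: GanyushkinMazorchuk2009, Proposition 8.1.2 and Corollary 8.1.3] -/
theorem list_prod_eq_zero_of_forall_isNilpotent (S : Subsemigroup M) (hS : (S : Set M).Finite)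
    (h0 : (0 : M) ∈ S) (hnil : ∀ a ∈ S, IsNilpotent a) (l : List M) (hl : ∀ a ∈ l, a ∈ S)
    (hk : (S : Set M).ncard ≤ l.length) : l.prod = 0 := by
  classical
  by_contra hne
  set n := (S : Set M).ncard with hn
  -- the prefixes `b i = (l.take (i+1)).prod`, `i < n`
  let b : Fin n → M := fun i => (l.take (i.val + 1)).prod
  have hlen : ∀ i : Fin n, i.val + 1 ≤ l.length := fun i => by have := i.isLt; omega
  have hbS : ∀ i, b i ∈ (S : Set M) \ {0} := by
    intro i
    refine ⟨list_prod_mem ?_ fun a ha => hl a (List.mem_of_mem_take ha), fun hb => hne ?_⟩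
    · intro h
      have := congrArg List.length h
      rw [List.length_take, List.length_nil] at this
      have := hlen i
      omega
    · rw [Set.mem_singleton_iff] at hb
      rw [← List.prod_take_mul_prod_drop l (i.val + 1), show (l.take (i.val + 1)).prod = 0 from hb,
        zero_mul]
  have hbinj : Function.Injective b := by
    intro i j hij
    by_contra hne'
    wlog hlt : i.val < j.val generalizing i j
    · exact this hij.symm (Ne.symm hne') (lt_of_le_of_ne (not_lt.1 hlt)
        (fun h => hne' (Fin.ext h.symm)))
    -- `b j = b i * x` with `x` the product of the entries `i+1, …, j`
    let x := ((l.drop (i.val + 1)).take (j.val - i.val)).prod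
    have hx : b j = b i * x := by
      show (l.take (j.val + 1)).prod = (l.take (i.val + 1)).prod * _
      rw [← List.prod_append, ← List.take_add]
      congr 2
      omega
    have hxS : x ∈ S := by
      refine list_prod_mem ?_ fun a ha => hl a (List.mem_of_mem_drop (List.mem_of_mem_take ha))
      intro h
      have := congrArg List.length h
      rw [List.length_take, List.length_drop, List.length_nil] at this
      have := hlen j
      omega
    obtain ⟨m, hm⟩ := hnil x hxS
    have := mul_pow_eq_self (hij.trans hx).symm m
    -- `b i * x ^ m = b i`, but `x ^ m = 0`
    rw [hm, mul_zero] at this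
    exact (hbS i).2 this.symm
  -- `n` distinct elements of `S ∖ {0}`, which has only `n - 1` elements
  have hcard : (Finset.univ.image b).card ≤ ((S : Set M) \ {0}).ncard := by
    rw [← Set.ncard_coe_finset]
    exact Set.ncard_le_ncard (fun y hy => by
      obtain ⟨i, -, rfl⟩ := Finset.mem_image.1 (Finset.mem_coe.1 hy)
      exact hbS i) (hS.subset Set.sdiff_subset)
  rw [Finset.card_image_of_injective _ hbinj, Finset.card_univ, Fintype.card_fin,
    Set.ncard_sdiff_singleton_of_mem h0] at hcard
  have hpos : 0 < n := by
    rw [hn]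
    exact (Set.ncard_pos hS).2 ⟨0, h0⟩
  omega

/-- Proposition 8.1.2, (a) ⇒ (b): if every product of `k` elements of `S` vanishes then every
element of `S` is nilpotent (`aᵏ = 0`). [cite: GanyushkinMazorchuk2009, Proposition 8.1.2] -/
theorem isNilpotent_of_list_prod_eq_zero (S : Subsemigroup M) {k : ℕ}
    (h : ∀ l : List M, (∀ a ∈ l, a ∈ S) → k ≤ l.length → l.prod = 0) {a : M} (ha : a ∈ S) :
    IsNilpotent a :=
  ⟨k, by
    rw [← List.prod_replicate]
    exact h _ (fun x hx => (List.eq_of_mem_replicate hx).symm ▸ ha) (by simp)⟩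

end Literature.Algebra.Semigroups.Nilpotent
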